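import Mathlib
import Literature.Topology.FourManifolds.DehnSurgeryRotationField
import HarnessLib

/-!
# Plane angles: an explicit smooth lift of the angle between two unit vectors (layer `f3_planeAngle`)

Auxiliary file (layer 3) of stub `helper_sliceGluing_bottConstruction` (apex brick F3: the
construction of the Morse–Bott function `F` and of the angular map `α`), line `Sketch`, crux
`SblfDescent.RungOne`.

(Crux item stmt-SmoothPoincare4-18531; skeleton `Cruxes/RungOne/Lines/Sketch.lean`.)

The angular map of brick F3 interpolates, on a slab of the sphere side, between two unit
vector fields `ũ` (the base longitude) and `â` (the transported torus coordinate) through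
`α = R(λ(h) · δ̃) ũ`, where `δ̃ ∈ (0, 2π)` is a *real* lift of the angle `δ` from `ũ` to `â` and
`R(θ)` is the rotation by `θ`.  Such a lift exists and is smooth as soon as `â ≠ ũ` (which the
level clause of the torus angular coordinate guarantees on that slab), by the explicit
half-angle formula
`δ̃ = π - 2 arctan (s / (1 - c))`, `c = ⟪ũ, â⟫ = cos δ`, `s = ũ × â = sin δ`
(indeed `tan ((δ - π)/2) = -cot (δ/2) = -s / (1 - c)` for `δ ∈ (0, 2π)`).  This file is the
plane trigonometry of that formula, in coordinates on `ℝ² = EuclideanSpace ℝ (Fin 2)`: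

* `cos_angleLift`, `sin_angleLift`: `cos δ̃ = c`, `sin δ̃ = s` for unit `u`, `a` with `c ≠ 1`;
* `0 < δ̃ < 2π` (range of `arctan`);
* `contDiffAt_angleLift`: `(u, a) ↦ δ̃` is smooth where `c ≠ 1`;
* `rot_angleLift`: the rotation by `δ̃` takes `u` to `a`; `norm_rot`: rotations are isometries;
* `inner_coord_eq_one_iff`: for unit vectors `c = 1 ↔ a = u` (so `δ̃` is defined off the
  diagonal);
* the registered statement `helper_f3_planeAngle` packages these.

## References

* J. Milnor, *Morse theory*, Ann. of Math. Studies 51 (1963), §2–§3 (auxiliary functions in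
  the manipulation of Morse functions; the half-angle substitution is classical plane
  trigonometry). [Milnor1963]
-/

set_option linter.dupNamespace false

noncomputable section

open scoped ContDiff Topology
open Set Filter Real Literature.Topology.FourManifolds

namespace Summit.SmoothPoincare4.SmoothPoincare4.Cruxes.RungOne.Sketch

/-! ### Unit vectors in coordinates -/

/-- **Lagrange's identity in the plane**: `c² + s² = 1` for the cosine `c = u₀ a₀ + u₁ a₁` and
the sine `s = u₀ a₁ - u₁ a₀` of the angle between two unit vectors. [folklore] -/
theorem cos_sq_add_sin_sq_coord {u a : EuclideanSpace ℝ (Fin 2)} (hu : ‖u‖ = 1) (ha : ‖a‖ = 1) :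
    (u 0 * a 0 + u 1 * a 1) ^ 2 + (u 0 * a 1 - u 1 * a 0) ^ 2 = 1 := by
  have h1 := (by rw [← norm_sq_eq_add_sq, hu, one_pow] : u 0 ^ 2 + u 1 ^ 2 = 1)
  have h2 := (by rw [← norm_sq_eq_add_sq, ha, one_pow] : a 0 ^ 2 + a 1 ^ 2 = 1)
  have : (u 0 * a 0 + u 1 * a 1) ^ 2 + (u 0 * a 1 - u 1 * a 0) ^ 2 =
      (u 0 ^ 2 + u 1 ^ 2) * (a 0 ^ 2 + a 1 ^ 2) := by ring
  rw [this, h1, h2, one_mul]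

/-- The cosine of the angle between unit vectors is at most `1`. [folklore] -/
theorem inner_coord_le_one {u a : EuclideanSpace ℝ (Fin 2)} (hu : ‖u‖ = 1) (ha : ‖a‖ = 1) :
    u 0 * a 0 + u 1 * a 1 ≤ 1 := by
  nlinarith [cos_sq_add_sin_sq_coord hu ha, sq_nonneg (u 0 * a 1 - u 1 * a 0),
    sq_nonneg (u 0 * a 0 + u 1 * a 1 - 1)]

/-- The cosine of the angle between unit vectors is at least `-1`. [folklore] -/
theorem neg_one_le_inner_coord {u a : EuclideanSpace ℝ (Fin 2)} (hu : ‖u‖ = 1) (ha : ‖a‖ = 1) :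
    -1 ≤ u 0 * a 0 + u 1 * a 1 := by
  nlinarith [cos_sq_add_sin_sq_coord hu ha, sq_nonneg (u 0 * a 1 - u 1 * a 0),
    sq_nonneg (u 0 * a 0 + u 1 * a 1 + 1)]

/-- **Unit vectors coincide iff the cosine of their angle is `1`.** [folklore] -/
theorem inner_coord_eq_one_iff {u a : EuclideanSpace ℝ (Fin 2)} (hu : ‖u‖ = 1) (ha : ‖a‖ = 1) :
    u 0 * a 0 + u 1 * a 1 = 1 ↔ a = u := by
  have h1 := (by rw [← norm_sq_eq_add_sq, hu, one_pow] : u 0 ^ 2 + u 1 ^ 2 = 1)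
  have h2 := (by rw [← norm_sq_eq_add_sq, ha, one_pow] : a 0 ^ 2 + a 1 ^ 2 = 1)
  constructor
  · intro h
    -- `‖a - u‖² = 2 - 2c = 0`
    have h0 : (a 0 - u 0) ^ 2 + (a 1 - u 1) ^ 2 = 0 := by nlinarith
    have e0 : a 0 - u 0 = 0 := by nlinarith [sq_nonneg (a 0 - u 0), sq_nonneg (a 1 - u 1)]
    have e1 : a 1 - u 1 = 0 := by nlinarith [sq_nonneg (a 0 - u 0), sq_nonneg (a 1 - u 1)]
    ext i
    fin_cases i
    · exact sub_eq_zero.1 e0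
    · exact sub_eq_zero.1 e1
  · rintro rfl
    nlinarith

/-- **Unit vectors are opposite iff the cosine of their angle is `-1`.** [folklore] -/
theorem inner_coord_eq_neg_one_iff {u a : EuclideanSpace ℝ (Fin 2)} (hu : ‖u‖ = 1) (ha : ‖a‖ = 1) :
    u 0 * a 0 + u 1 * a 1 = -1 ↔ a = -u := by
  have h1 := (by rw [← norm_sq_eq_add_sq, hu, one_pow] : u 0 ^ 2 + u 1 ^ 2 = 1)
  have h2 := (by rw [← norm_sq_eq_add_sq, ha, one_pow] : a 0 ^ 2 + a 1 ^ 2 = 1)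
  constructor
  · intro h
    have h0 : (a 0 + u 0) ^ 2 + (a 1 + u 1) ^ 2 = 0 := by nlinarith
    have e0 : a 0 + u 0 = 0 := by nlinarith [sq_nonneg (a 0 + u 0), sq_nonneg (a 1 + u 1)]
    have e1 : a 1 + u 1 = 0 := by nlinarith [sq_nonneg (a 0 + u 0), sq_nonneg (a 1 + u 1)]
    ext i
    fin_cases i
    · simpa using eq_neg_of_add_eq_zero_left e0
    · simpa using eq_neg_of_add_eq_zero_left e1
  · rintro rfl
    simp only [PiLp.neg_apply]
    nlinarith

/-! ### The half-angle lift `δ̃ = π - 2 arctan (s / (1 - c))` -/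

/-- The key identity of the half-angle substitution: `1 + (s / (1 - c))² = 2 / (1 - c)` when
`c² + s² = 1`, `c ≠ 1`. [folklore] -/
theorem one_add_sq_halfAngle {c s : ℝ} (hcs : c ^ 2 + s ^ 2 = 1) (hc : c ≠ 1) :
    1 + (s / (1 - c)) ^ 2 = 2 / (1 - c) := by
  have h1c : 1 - c ≠ 0 := sub_ne_zero.2 (Ne.symm hc)
  have hs2 : s ^ 2 = (1 - c) * (1 + c) := by nlinarith
  field_simp
  nlinarith [hs2]

/-- **Cosine of the lift**: `cos (π - 2 arctan (s / (1 - c))) = c` when `c² + s² = 1`, `c ≠ 1`.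
[folklore] -/
theorem cos_halfAngleLift {c s : ℝ} (hcs : c ^ 2 + s ^ 2 = 1) (hc : c ≠ 1) :
    Real.cos (π - 2 * Real.arctan (s / (1 - c))) = c := by
  have h1c : 1 - c ≠ 0 := sub_ne_zero.2 (Ne.symm hc)
  rw [Real.cos_pi_sub, Real.cos_two_mul, Real.cos_sq_arctan, one_add_sq_halfAngle hcs hc]
  field_simp
  ring

/-- **Sine of the lift**: `sin (π - 2 arctan (s / (1 - c))) = s` when `c² + s² = 1`, `c ≠ 1`.
[folklore] -/
theorem sin_halfAngleLift {c s : ℝ} (hcs : c ^ 2 + s ^ 2 = 1) (hc : c ≠ 1) :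
    Real.sin (π - 2 * Real.arctan (s / (1 - c))) = s := by
  have h1c : 1 - c ≠ 0 := sub_ne_zero.2 (Ne.symm hc)
  have hpos : 0 < 1 + (s / (1 - c)) ^ 2 := by positivity
  rw [Real.sin_pi_sub, Real.sin_two_mul, Real.sin_arctan, Real.cos_arctan]
  have : 2 * (s / (1 - c) / √(1 + (s / (1 - c)) ^ 2)) * (1 / √(1 + (s / (1 - c)) ^ 2)) =
      2 * (s / (1 - c)) / (√(1 + (s / (1 - c)) ^ 2) ^ 2) := by ring
  rw [this, Real.sq_sqrt hpos.le, one_add_sq_halfAngle hcs hc]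
  field_simp

/-! ### The lift of the angle between two unit plane vectors -/

section Vectors

variable {u a : EuclideanSpace ℝ (Fin 2)}

/-- **Cosine of the angle lift**: for unit `u ≠ a`,
`cos δ̃ = ⟪u, a⟫ = u₀ a₀ + u₁ a₁`, `δ̃ = π - 2 arctan (s / (1 - c))`. [folklore] -/
theorem cos_angleLift (hu : ‖u‖ = 1) (ha : ‖a‖ = 1) (hne : a ≠ u) :
    Real.cos (π - 2 * Real.arctan ((u 0 * a 1 - u 1 * a 0) / (1 - (u 0 * a 0 + u 1 * a 1)))) =
      u 0 * a 0 + u 1 * a 1 :=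
  cos_halfAngleLift (cos_sq_add_sin_sq_coord hu ha)
    (fun h => hne ((inner_coord_eq_one_iff hu ha).1 h))

/-- **Sine of the angle lift**: for unit `u ≠ a`, `sin δ̃ = u × a = u₀ a₁ - u₁ a₀`. [folklore] -/
theorem sin_angleLift (hu : ‖u‖ = 1) (ha : ‖a‖ = 1) (hne : a ≠ u) :
    Real.sin (π - 2 * Real.arctan ((u 0 * a 1 - u 1 * a 0) / (1 - (u 0 * a 0 + u 1 * a 1)))) =
      u 0 * a 1 - u 1 * a 0 :=
  sin_halfAngleLift (cos_sq_add_sin_sq_coord hu ha)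
    (fun h => hne ((inner_coord_eq_one_iff hu ha).1 h))

/-- **Rotating `u` by the angle lift gives `a`** (first coordinate):
`cos δ̃ u₀ - sin δ̃ u₁ = a₀`. [folklore] -/
theorem rot_angleLift_fst (hu : ‖u‖ = 1) (ha : ‖a‖ = 1) (hne : a ≠ u) :
    Real.cos (π - 2 * Real.arctan ((u 0 * a 1 - u 1 * a 0) / (1 - (u 0 * a 0 + u 1 * a 1)))) * u 0 -
      Real.sin (π - 2 * Real.arctan ((u 0 * a 1 - u 1 * a 0) / (1 - (u 0 * a 0 + u 1 * a 1)))) * u 1 =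
      a 0 := by
  rw [cos_angleLift hu ha hne, sin_angleLift hu ha hne]
  have h1 := (by rw [← norm_sq_eq_add_sq, hu, one_pow] : u 0 ^ 2 + u 1 ^ 2 = 1)
  linear_combination a 0 * h1

/-- **Rotating `u` by the angle lift gives `a`** (second coordinate):
`sin δ̃ u₀ + cos δ̃ u₁ = a₁`. [folklore] -/
theorem rot_angleLift_snd (hu : ‖u‖ = 1) (ha : ‖a‖ = 1) (hne : a ≠ u) :
    Real.sin (π - 2 * Real.arctan ((u 0 * a 1 - u 1 * a 0) / (1 - (u 0 * a 0 + u 1 * a 1)))) * u 0 +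
      Real.cos (π - 2 * Real.arctan ((u 0 * a 1 - u 1 * a 0) / (1 - (u 0 * a 0 + u 1 * a 1)))) * u 1 =
      a 1 := by
  rw [cos_angleLift hu ha hne, sin_angleLift hu ha hne]
  have h1 := (by rw [← norm_sq_eq_add_sq, hu, one_pow] : u 0 ^ 2 + u 1 ^ 2 = 1)
  linear_combination a 1 * h1

end Vectors

/-! ### Rotations of the plane -/

/-- **Rotations are isometries**: `‖(cos θ w₀ - sin θ w₁, sin θ w₀ + cos θ w₁)‖ = ‖w‖`.
[folklore] -/
theorem norm_rot (θ : ℝ) (w : EuclideanSpace ℝ (Fin 2)) :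
    ‖!₂[Real.cos θ * w 0 - Real.sin θ * w 1, Real.sin θ * w 0 + Real.cos θ * w 1]‖ = ‖w‖ := by
  have h : ‖!₂[Real.cos θ * w 0 - Real.sin θ * w 1, Real.sin θ * w 0 + Real.cos θ * w 1]‖ ^ 2 =
      ‖w‖ ^ 2 := by
    rw [norm_sq_eq_add_sq, norm_sq_eq_add_sq]
    have hcs := Real.cos_sq_add_sin_sq θ
    simp only [Matrix.cons_val_zero, Matrix.cons_val_one, Matrix.cons_val_fin_one]
    linear_combination (w 0 ^ 2 + w 1 ^ 2) * hcs
  exact (pow_left_inj₀ (norm_nonneg _) (norm_nonneg _) two_ne_zero).1 h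

/-- The rotation by `0` is the identity. [folklore] -/
theorem rot_zero (w : EuclideanSpace ℝ (Fin 2)) :
    !₂[Real.cos 0 * w 0 - Real.sin 0 * w 1, Real.sin 0 * w 0 + Real.cos 0 * w 1] = w := by
  ext i
  fin_cases i <;> simp

/-- **The rotation by the angle lift takes `u` to `a`** (unit `u ≠ a`). [folklore] -/
theorem rot_angleLift {u a : EuclideanSpace ℝ (Fin 2)} (hu : ‖u‖ = 1) (ha : ‖a‖ = 1) (hne : a ≠ u) :
    !₂[Real.cos (π - 2 * Real.arctan ((u 0 * a 1 - u 1 * a 0) / (1 - (u 0 * a 0 + u 1 * a 1)))) * u 0 -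
        Real.sin (π - 2 * Real.arctan ((u 0 * a 1 - u 1 * a 0) / (1 - (u 0 * a 0 + u 1 * a 1)))) * u 1,
      Real.sin (π - 2 * Real.arctan ((u 0 * a 1 - u 1 * a 0) / (1 - (u 0 * a 0 + u 1 * a 1)))) * u 0 +
        Real.cos (π - 2 * Real.arctan ((u 0 * a 1 - u 1 * a 0) / (1 - (u 0 * a 0 + u 1 * a 1)))) * u 1] =
      a := by
  ext i
  fin_cases i
  · simpa using rot_angleLift_fst hu ha hne
  · simpa using rot_angleLift_snd hu ha hne

/-! ### Smoothness of the lift -/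

/-- **The angle lift is smooth off the diagonal**: `(u, a) ↦ π - 2 arctan (s / (1 - c))` is
smooth at every pair with `c = u₀ a₀ + u₁ a₁ ≠ 1`. [folklore] -/
theorem contDiffAt_angleLift {n : ℕ∞} (p : EuclideanSpace ℝ (Fin 2) × EuclideanSpace ℝ (Fin 2))
    (hp : p.1 0 * p.2 0 + p.1 1 * p.2 1 ≠ 1) :
    ContDiffAt ℝ n (fun q : EuclideanSpace ℝ (Fin 2) × EuclideanSpace ℝ (Fin 2) =>
      π - 2 * Real.arctan ((q.1 0 * q.2 1 - q.1 1 * q.2 0) / (1 - (q.1 0 * q.2 0 + q.1 1 * q.2 1)))) p := by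
  have h1 : ∀ i : Fin 2, ContDiffAt ℝ n
      (fun q : EuclideanSpace ℝ (Fin 2) × EuclideanSpace ℝ (Fin 2) => q.1 i) p := fun i =>
    ((EuclideanSpace.proj i : EuclideanSpace ℝ (Fin 2) →L[ℝ] ℝ).contDiff.comp contDiff_fst).contDiffAt
  have h2 : ∀ i : Fin 2, ContDiffAt ℝ n
      (fun q : EuclideanSpace ℝ (Fin 2) × EuclideanSpace ℝ (Fin 2) => q.2 i) p := fun i =>
    ((EuclideanSpace.proj i : EuclideanSpace ℝ (Fin 2) →L[ℝ] ℝ).contDiff.comp contDiff_snd).contDiffAt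
  have hden : ContDiffAt ℝ n (fun q : EuclideanSpace ℝ (Fin 2) × EuclideanSpace ℝ (Fin 2) =>
      1 - (q.1 0 * q.2 0 + q.1 1 * q.2 1)) p :=
    contDiffAt_const.sub (((h1 0).mul (h2 0)).add ((h1 1).mul (h2 1)))
  have hnum : ContDiffAt ℝ n (fun q : EuclideanSpace ℝ (Fin 2) × EuclideanSpace ℝ (Fin 2) =>
      q.1 0 * q.2 1 - q.1 1 * q.2 0) p :=
    ((h1 0).mul (h2 1)).sub ((h1 1).mul (h2 0))
  have hq := hnum.div hden (sub_ne_zero.2 (Ne.symm hp))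
  exact contDiffAt_const.sub (contDiffAt_const.mul (Real.contDiff_arctan.contDiffAt.comp p hq))

/-- **Layer `f3_planeAngle` of brick F3: the explicit smooth lift of a plane angle.**  For unit
vectors `u ≠ a` of the plane, the real number `δ̃ = π - 2 arctan (s / (1 - c))`
(`c = u₀ a₀ + u₁ a₁`, `s = u₀ a₁ - u₁ a₀`) lies in `(0, 2π)`, has `cos δ̃ = c`, `sin δ̃ = s`, the
rotation by `δ̃` takes `u` to `a`, and `(u, a) ↦ δ̃` is smooth off the diagonal `{c = 1}`
(`c = 1 ↔ a = u` for unit vectors); rotations are isometries.  This is the interpolation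
device `α = R(λ δ̃) ũ` of the angular map of brick F3 (classical half-angle trigonometry;
auxiliary functions as in Milnor 1963, §3). [cite: Milnor1963, §3] -/
theorem helper_f3_planeAngle : (∀ (u a : EuclideanSpace ℝ (Fin 2)), ‖u‖ = 1 → ‖a‖ = 1 → (u 0 * a 0 + u 1 * a 1 = 1 ↔ a = u)) ∧ (∀ (u a : EuclideanSpace ℝ (Fin 2)), ‖u‖ = 1 → ‖a‖ = 1 → a ≠ u → 0 < π - 2 * Real.arctan ((u 0 * a 1 - u 1 * a 0) / (1 - (u 0 * a 0 + u 1 * a 1))) ∧ π - 2 * Real.arctan ((u 0 * a 1 - u 1 * a 0) / (1 - (u 0 * a 0 + u 1 * a 1))) < 2 * π ∧ Real.cos (π - 2 * Real.arctan ((u 0 * a 1 - u 1 * a 0) / (1 - (u 0 * a 0 + u 1 * a 1)))) = u 0 * a 0 + u 1 * a 1 ∧ Real.sin (π - 2 * Real.arctan ((u 0 * a 1 - u 1 * a 0) / (1 - (u 0 * a 0 + u 1 * a 1)))) = u 0 * a 1 - u 1 * a 0 ∧ !₂[Real.cos (π - 2 * Real.arctan ((u 0 * a 1 - u 1 * a 0)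 / (1 - (u 0 * a 0 + u 1 * a 1)))) * u 0 - Real.sin (π - 2 * Real.arctan ((u 0 * a 1 - u 1 * a 0) / (1 - (u 0 * a 0 + u 1 * a 1)))) * u 1, Real.sin (π - 2 * Real.arctan ((u 0 * a 1 - u 1 * a 0) / (1 - (u 0 * a 0 + u 1 * a 1)))) * u 0 + Real.cos (π - 2 * Real.arctan ((u 0 * a 1 - u 1 * a 0) / (1 - (u 0 * a 0 + u 1 * a 1)))) * u 1] = a) ∧ (∀ (p : EuclideanSpace ℝ (Fin 2) × EuclideanSpace ℝ (Fin 2)), p.1 0 * p.2 0 + p.1 1 * p.2 1 ≠ 1 → ContDiffAt ℝ ∞ (fun q : EuclideanSpace ℝ (Fin 2) × EuclideanSpace ℝ (Fin 2) => π - 2 * Real.arctan ((q.1 0 * q.2 1 - q.1 1 * q.2 0) / (1 - (q.1 0 * q.2 0 + q.1 1 * q.2 1)))) p) ∧ (∀ (θ : ℝ) (w : EuclideanSpace ℝ (Fin 2)), ‖!₂[Real.cos θ * w 0 - Real.sin θ * w 1, Real.sin θ * w 0 + Real.cos θ * w 1]‖ = ‖w‖) := by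
  refine ⟨fun u a hu ha => inner_coord_eq_one_iff hu ha, fun u a hu ha hne => ?_,
    fun p hp => contDiffAt_angleLift p hp, norm_rot⟩
  exact ⟨by linarith [Real.arctan_lt_pi_div_two ((u 0 * a 1 - u 1 * a 0) / (1 - (u 0 * a 0 + u 1 * a 1)))],
    by linarith [Real.neg_pi_div_two_lt_arctan ((u 0 * a 1 - u 1 * a 0) / (1 - (u 0 * a 0 + u 1 * a 1)))],
    cos_angleLift hu ha hne,
    sin_angleLift hu ha hne, rot_angleLift hu ha hne⟩

end Summit.SmoothPoincare4.SmoothPoincare4.Cruxes.RungOne.Sketch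

end
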